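import Summits.NavierStokesRegularity.NavierStokesRegularity.Theorems.AxisymmetricExtremalityAxisymmetricKatoGlobalStubSeregin2020TypeIILemma22SublevelEnergyTools
import Literature.Analysis.FluidPDE.KNSSSwirlTransport
import HarnessLib

/-!
# Seregin 2020, Lemma 2.2 (after Nazarov–Uraltseva 2012): the slice estimate of N–U Lemma 3.2
# (propagation of density) from the energy-inequality class

Helper toward the stub `stub_seregin2020TypeII` of the crux `AxisymmetricKatoGlobal` (= the named
fact `Literature.Analysis.FluidPDE.Seregin2020_axisymmetricSingularPoint_typeII`, Seregin 2020,
Thm 2.1), reduced in the tree to the written-out hypothesis `hWH′` (= N–U 2012 Lemma 4.2 for the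
class 𝒱). N–U Lemma 3.2 (the atom `stub_L32_densityPropagation` of the cell's De Giorgi
skeleton `Cruxes/AxisymmetricKatoGlobal/Seregin2020Lemma22ExpansionOfPositivity.lean`) rests on
ONE slice estimate, obtained by testing the energy inequality (3.9) with `(V - k)₋² ζ²`
between the initial time `t₁` and the slice time `t̄`:
`(1-γ)²k² |{V(t̄) < γk} ∩ B_{(1-σ)R}| ≤ ∫(V-k)₋²ζ²|_{t̄} ≤ ∫(V-k)₋²ζ²|_{t₁} + drift/cut-off errors`.
This file proves that estimate from the ENERGY-INEQUALITY CLASS (`EnergyClass`, written out,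
right-hand side parenthesised `η t₁ (∫ …) + ∫∫ …`) with the `C²` profile `H(τ) = ((κ - τ)₊)³`
(written as `((2l - τ)₊)³`, `l = κ/2`, to reuse `cubeProfile_props`), `η ≡ 1` and the radial
cut-off `Θ = radialCutoff ρ ρ₁` (`= 1` on `B(ρ)`, `= 0` off `B(ρ₁)`):

* `measure_sublevel_slice_le_of_energyClass` — for `0 < ρ < ρ₁ < 2R`, `-R² < a ≤ t < 0`,
  `0 < κ ≤ k`, `0 < γ < 1`:
  `((1-γ)κ)³ |B(ρ) ∩ {Φ(t,·) < γκ}| ≤ κ³ |B(ρ₁) ∩ {Φ(a,·) < κ}|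
     + κ³ (4A²(t-a)|B̄(ρ₁)| + 2A I_U + 4A I_ϱ)`, `A = C_g/(ρ₁-ρ)`,
  `I_U ≥ ∫∫_{[a,t]×B̄(ρ₁)} |U|`, `I_ϱ ≥ ∫∫_{[a,t]×B̄(ρ₁)} 1/ϱ`.

## References

* A. I. Nazarov, N. N. Uraltseva, St. Petersburg Math. J. 23 (2012) 93–115 = arXiv:1011.1888,
  §3, Lemma 3.2 and its proof ((3.9) with `η = χ_{t<t̄}(V-k)₋ζ²`), Remark 9. [NazarovUraltseva2012]
* G. Seregin, Anal. Math. Phys. 10 (2020), Paper 46 = arXiv:2006.04140, Lemma 2.2. [Seregin2020]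
-/

-- the problem directory repeats the summit name (D-0017); core's `dupNamespace` linter fires
set_option linter.dupNamespace false

noncomputable section

open MeasureTheory Set Function Filter Topology Metric Module
open scoped NNReal ENNReal

namespace Summit.NavierStokesRegularity.NavierStokesRegularity.Theorems.AxisymmetricKatoGlobal.EulerScaling

open Literature.Analysis.FluidPDE Literature.Analysis.FluidPDE.LeiZhang2011

set_option maxHeartbeats 400000 in
/-- **Nazarov–Uraltseva 2012, the slice estimate of Lemma 3.2 (propagation of density), in
Seregin's class 𝒱, from the energy class.** See the module docstring for the statement; `hEC`
is `EnergyClass Φ U k R` of the De Giorgi skeleton written out.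
[cite: NazarovUraltseva2012, Lemma 3.2 (proof), Remark 9; Seregin2020, Lemma 2.2] -/
theorem measure_sublevel_slice_le_of_energyClass
    (Φ : ℝ → EuclideanSpace ℝ (Fin 3) → ℝ)
    (U : ℝ → EuclideanSpace ℝ (Fin 3) → EuclideanSpace ℝ (Fin 3)) (k R : ℝ)
    (hΦm : Measurable (uncurry Φ)) (hΦ0 : ∀ t x, 0 ≤ Φ t x)
    (hU : AEStronglyMeasurable (uncurry U)
      (volume.restrict (Ioo (-R ^ 2) 0 ×ˢ ball (0 : EuclideanSpace ℝ (Fin 3)) (2 * R))))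
    (hEC : ∀ (H : ℝ → ℝ), ContDiff ℝ 2 H → (∀ v, deriv H v ≤ 0) → (∀ v, 0 ≤ H v) →
      (∀ v, 0 ≤ deriv (deriv H) v) → (∀ v, deriv H v ^ 2 ≤ 2 * H v * deriv (deriv H) v) →
      (∀ v, k ≤ v → H v = 0) →
      ∀ (Θ : EuclideanSpace ℝ (Fin 3) → ℝ), ContDiff ℝ 1 Θ → HasCompactSupport Θ →
        tsupport Θ ⊆ ball (0 : EuclideanSpace ℝ (Fin 3)) (2 * R) →
      ∀ (η : ℝ → ℝ), ContDiff ℝ 1 η → (∀ s, 0 ≤ η s) →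
      ∀ (t₁ t₂ : ℝ), -R ^ 2 < t₁ → t₁ ≤ t₂ → t₂ < 0 →
        ENNReal.ofReal (η t₂ * ∫ x, H (Φ t₂ x) * Θ x ^ 2) +
          ∫⁻ z in Icc t₁ t₂ ×ˢ (univ : Set (EuclideanSpace ℝ (Fin 3))), ENNReal.ofReal
            (1 / 2 * η z.1 * (deriv (deriv H) (Φ z.1 z.2) * ‖gradient (Φ z.1) z.2‖ ^ 2 *
              Θ z.2 ^ 2))
        ≤ ENNReal.ofReal (η t₁ * (∫ x, H (Φ t₁ x) * Θ x ^ 2) +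
            ∫ z in Icc t₁ t₂ ×ˢ (univ : Set (EuclideanSpace ℝ (Fin 3))),
              (4 * η z.1 * (H (Φ z.1 z.2) * ‖gradient Θ z.2‖ ^ 2) +
                η z.1 * (H (Φ z.1 z.2) * inner ℝ (U z.1 z.2) (gradient (fun y => Θ y ^ 2) z.2)) +
                η z.1 * (2 / cylRadius z.2 *
                  (H (Φ z.1 z.2) * fderiv ℝ (fun y => Θ y ^ 2) z.2 (eR z.2))) +
                |deriv η z.1| * (H (Φ z.1 z.2) * Θ z.2 ^ 2))))
    {ρ ρ₁ a t₀ κ γ : ℝ} (hρ : 0 < ρ) (hρ₁ : ρ < ρ₁) (hρ₁R : ρ₁ < 2 * R) (ha : -R ^ 2 < a)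
    (hat : a ≤ t₀) (ht₀ : t₀ < 0) (hκ : 0 < κ) (hκk : κ ≤ k) (hγ : 0 < γ) (hγ1 : γ < 1)
    {Cg : ℝ} (hCg0 : 0 ≤ Cg)
    (hCg : ∀ x, ‖fderiv ℝ (radialCutoff ρ ρ₁ : EuclideanSpace ℝ (Fin 3) → ℝ) x‖ ≤ Cg / (ρ₁ - ρ))
    {IU Iϱ : ℝ≥0∞} (hIUfin : IU ≠ ∞) (hIϱfin : Iϱ ≠ ∞)
    (hIU : ∫⁻ z in Icc a t₀ ×ˢ closedBall (0 : EuclideanSpace ℝ (Fin 3)) ρ₁, ‖U z.1 z.2‖ₑ ≤ IU)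
    (hIϱ : ∫⁻ z in Icc a t₀ ×ˢ closedBall (0 : EuclideanSpace ℝ (Fin 3)) ρ₁,
      ENNReal.ofReal (cylRadius z.2)⁻¹ ≤ Iϱ) :
    ((1 - γ) * κ) ^ 3 *
        (volume (ball (0 : EuclideanSpace ℝ (Fin 3)) ρ ∩ {x | Φ t₀ x < γ * κ})).toReal ≤
      κ ^ 3 * (volume (ball (0 : EuclideanSpace ℝ (Fin 3)) ρ₁ ∩ {x | Φ a x < κ})).toReal +
        κ ^ 3 * (4 * (Cg / (ρ₁ - ρ)) ^ 2 * ((t₀ - a) *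
            (volume (closedBall (0 : EuclideanSpace ℝ (Fin 3)) ρ₁)).toReal) +
          2 * (Cg / (ρ₁ - ρ)) * IU.toReal + 4 * (Cg / (ρ₁ - ρ)) * Iϱ.toReal) := by
  -- the profile `((κ - τ)₊)³ = ((2l - τ)₊)³`, `l = κ/2`
  set l : ℝ := κ / 2 with hl_def
  have hl : 0 < l := by positivity
  have hlk : 2 * l ≤ k := by rw [hl_def]; linarith
  have h2l : 2 * l = κ := by rw [hl_def]; ring
  -- ### notation
  set K : Set (EuclideanSpace ℝ (Fin 3)) := closedBall (0 : EuclideanSpace ℝ (Fin 3)) ρ₁ with hK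
  set VK : ℝ := (volume K).toReal with hVK
  set A : ℝ := Cg / (ρ₁ - ρ) with hA
  have hρ₁pos : 0 < ρ₁ := hρ.trans hρ₁
  have hA0 : 0 ≤ A := by rw [hA]; exact div_nonneg hCg0 (by linarith)
  have hKm : MeasurableSet K := measurableSet_closedBall
  have hKfin : volume K < ∞ := measure_closedBall_lt_top
  have hta : 0 ≤ t₀ - a := by linarith
  -- ### the profile, the time factor, the cut-off
  set H : ℝ → ℝ := fun τ => max (2 * l - τ) 0 ^ (3 : ℝ) with hH
  obtain ⟨hH2, hH', hH0, hH'', hHsq, hH2l, hH8, -⟩ := cubeProfile_props hl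
  have hHk : ∀ v, k ≤ v → H v = 0 := fun v hv => hH2l v (hlk.trans hv)
  obtain ⟨hΘ1, hΘc, hΘK, hΘ01, hΘone, hΘzero⟩ := radialCutoff_energy_props hρ hρ₁
  set Θ : EuclideanSpace ℝ (Fin 3) → ℝ := radialCutoff ρ ρ₁ with hΘ
  have hΘsupp : tsupport Θ ⊆ ball (0 : EuclideanSpace ℝ (Fin 3)) (2 * R) :=
    hΘK.trans (closedBall_subset_ball hρ₁R)
  have hΘA : ∀ x, ‖fderiv ℝ Θ x‖ ≤ A := hCg
  set η : ℝ → ℝ := fun _ => 1 with hη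
  have hη1 : ContDiff ℝ 1 η := contDiff_const
  have hη0 : ∀ s, 0 ≤ η s := fun _ => zero_le_one
  -- ### Step 1: pointwise bound of the right-hand integrand by a majorant living on `K`
  set S : ℝ × EuclideanSpace ℝ (Fin 3) → ℝ := fun z =>
    4 * η z.1 * (H (Φ z.1 z.2) * ‖gradient Θ z.2‖ ^ 2) +
      η z.1 * (H (Φ z.1 z.2) * inner ℝ (U z.1 z.2) (gradient (fun y => Θ y ^ 2) z.2)) +
      η z.1 * (2 / cylRadius z.2 * (H (Φ z.1 z.2) * fderiv ℝ (fun y => Θ y ^ 2) z.2 (eR z.2))) +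
      |deriv η z.1| * (H (Φ z.1 z.2) * Θ z.2 ^ 2) with hS
  set c₁ : ℝ := 8 * l ^ 3 * (4 * A ^ 2) with hc₁
  set c₂ : ℝ := 8 * l ^ 3 * (2 * A) with hc₂
  set c₃ : ℝ := 8 * l ^ 3 * (4 * A) with hc₃
  have hc₁0 : 0 ≤ c₁ := by positivity
  have hc₂0 : 0 ≤ c₂ := by positivity
  have hc₃0 : 0 ≤ c₃ := by positivity
  set F : ℝ × EuclideanSpace ℝ (Fin 3) → ℝ≥0∞ := fun z =>
    ENNReal.ofReal c₁ + ENNReal.ofReal c₂ * ‖U z.1 z.2‖ₑ +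
      ENNReal.ofReal c₃ * ENNReal.ofReal (cylRadius z.2)⁻¹ with hF
  set G : ℝ × EuclideanSpace ℝ (Fin 3) → ℝ≥0∞ := fun z =>
    ((univ : Set ℝ) ×ˢ K).indicator F z with hG
  have hηz : ∀ s, η s = 1 := fun _ => rfl
  have hdη : ∀ s, deriv η s = 0 := fun s => by rw [hη]; exact deriv_const s 1
  have hSG : ∀ z, ‖S z‖ₑ ≤ G z := by
    intro z
    by_cases hz : z.2 ∈ K
    · have hind : G z = F z := by
        rw [hG]; exact indicator_of_mem (show z ∈ (univ : Set ℝ) ×ˢ K from ⟨mem_univ _, hz⟩) F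
      rw [hind, hF]
      -- real bound `|S z| ≤ c₁ + c₂ ‖U‖ + c₃ ϱ⁻¹`
      have hHle : H (Φ z.1 z.2) ≤ 8 * l ^ 3 := hH8 _ (hΦ0 _ _)
      have hHnn : 0 ≤ H (Φ z.1 z.2) := hH0 _
      have hgΘ : ‖gradient Θ z.2‖ ≤ A := by rw [norm_gradient_eq_norm_fderiv]; exact hΘA _
      have hgΘ2 : ‖gradient (fun y => Θ y ^ 2) z.2‖ ≤ 2 * A := by
        refine (norm_gradient_sq_le hΘ1 z.2).trans ?_
        have h1 : |Θ z.2| ≤ 1 := by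
          rw [abs_of_nonneg (hΘ01 z.2).1]; exact (hΘ01 z.2).2
        calc 2 * |Θ z.2| * ‖fderiv ℝ Θ z.2‖ ≤ 2 * 1 * A := by gcongr; exact hΘA _
          _ = 2 * A := by ring
      have hdΘ2 : |fderiv ℝ (fun y => Θ y ^ 2) z.2 (eR z.2)| ≤ 2 * A := by
        rw [fderiv_sq_apply hΘ1, abs_mul, abs_mul, abs_two, abs_of_nonneg (hΘ01 z.2).1]
        have h1 : |fderiv ℝ Θ z.2 (eR z.2)| ≤ A := by
          have h := ContinuousLinearMap.le_opNorm (fderiv ℝ Θ z.2) (eR z.2)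
          rw [Real.norm_eq_abs] at h
          calc |fderiv ℝ Θ z.2 (eR z.2)| ≤ ‖fderiv ℝ Θ z.2‖ * ‖eR z.2‖ := h
            _ ≤ A * 1 := by gcongr; exacts [hΘA _, norm_eR_le_one _]
            _ = A := mul_one A
        calc 2 * Θ z.2 * |fderiv ℝ Θ z.2 (eR z.2)| ≤ 2 * 1 * A := by
              gcongr; exact (hΘ01 z.2).2
          _ = 2 * A := by ring
      have hρinv : 0 ≤ (cylRadius z.2)⁻¹ := inv_nonneg.2 (cylRadius_nonneg _)
      have h2ρ : |2 / cylRadius z.2| = 2 * (cylRadius z.2)⁻¹ := by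
        rw [div_eq_mul_inv, abs_mul, abs_two, abs_of_nonneg hρinv]
      have hT1 : |4 * η z.1 * (H (Φ z.1 z.2) * ‖gradient Θ z.2‖ ^ 2)| ≤ c₁ := by
        rw [hηz z.1, mul_one, abs_mul, abs_of_nonneg (by norm_num : (0:ℝ) ≤ 4),
          abs_of_nonneg (mul_nonneg hHnn (sq_nonneg _)), hc₁]
        have : ‖gradient Θ z.2‖ ^ 2 ≤ A ^ 2 := pow_le_pow_left₀ (norm_nonneg _) hgΘ 2
        nlinarith [mul_le_mul hHle this (sq_nonneg _) (by positivity)]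
      have hT2 : |η z.1 * (H (Φ z.1 z.2) * inner ℝ (U z.1 z.2) (gradient (fun y => Θ y ^ 2) z.2))|
          ≤ c₂ * ‖U z.1 z.2‖ := by
        rw [hηz z.1, one_mul, abs_mul, abs_of_nonneg hHnn, hc₂]
        have hin : |inner ℝ (U z.1 z.2) (gradient (fun y => Θ y ^ 2) z.2)| ≤ ‖U z.1 z.2‖ * (2 * A) :=
          (abs_real_inner_le_norm _ _).trans (mul_le_mul_of_nonneg_left hgΘ2 (norm_nonneg _))
        calc H (Φ z.1 z.2) * |inner ℝ (U z.1 z.2) (gradient (fun y => Θ y ^ 2) z.2)|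
            ≤ 8 * l ^ 3 * (‖U z.1 z.2‖ * (2 * A)) :=
              mul_le_mul hHle hin (abs_nonneg _) (by positivity)
          _ = 8 * l ^ 3 * (2 * A) * ‖U z.1 z.2‖ := by ring
      have hT3 : |η z.1 * (2 / cylRadius z.2 *
          (H (Φ z.1 z.2) * fderiv ℝ (fun y => Θ y ^ 2) z.2 (eR z.2)))| ≤ c₃ * (cylRadius z.2)⁻¹ := by
        rw [hηz z.1, one_mul, abs_mul, h2ρ, abs_mul, abs_of_nonneg hHnn, hc₃]
        have : H (Φ z.1 z.2) * |fderiv ℝ (fun y => Θ y ^ 2) z.2 (eR z.2)| ≤ 8 * l ^ 3 * (2 * A) :=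
          mul_le_mul hHle hdΘ2 (abs_nonneg _) (by positivity)
        calc 2 * (cylRadius z.2)⁻¹ * (H (Φ z.1 z.2) * |fderiv ℝ (fun y => Θ y ^ 2) z.2 (eR z.2)|)
            ≤ 2 * (cylRadius z.2)⁻¹ * (8 * l ^ 3 * (2 * A)) :=
              mul_le_mul_of_nonneg_left this (by positivity)
          _ = 8 * l ^ 3 * (4 * A) * (cylRadius z.2)⁻¹ := by ring
      have hT4 : |deriv η z.1| * (H (Φ z.1 z.2) * Θ z.2 ^ 2) = 0 := by
        rw [hdη, abs_zero, zero_mul]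
      have hSabs : |S z| ≤ c₁ + c₂ * ‖U z.1 z.2‖ + c₃ * (cylRadius z.2)⁻¹ := by
        rw [hS]
        dsimp only
        rw [hT4, add_zero]
        refine (abs_add_le _ _).trans (add_le_add ((abs_add_le _ _).trans (add_le_add hT1 hT2)) hT3)
      calc ‖S z‖ₑ = ENNReal.ofReal |S z| := by rw [← Real.enorm_eq_ofReal_abs]
        _ ≤ ENNReal.ofReal (c₁ + c₂ * ‖U z.1 z.2‖ + c₃ * (cylRadius z.2)⁻¹) :=
            ENNReal.ofReal_le_ofReal hSabs
        _ = ENNReal.ofReal c₁ + ENNReal.ofReal c₂ * ‖U z.1 z.2‖ₑ +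
              ENNReal.ofReal c₃ * ENNReal.ofReal (cylRadius z.2)⁻¹ := by
            rw [ENNReal.ofReal_add (by positivity) (by positivity),
              ENNReal.ofReal_add (by positivity) (by positivity),
              ENNReal.ofReal_mul hc₂0, ENNReal.ofReal_mul hc₃0, ofReal_norm]
    · -- off `K` everything vanishes
      obtain ⟨hΘ0', hdΘ0, hg2⟩ := hΘzero z.2 hz
      have hg1 : gradient Θ z.2 = 0 := by
        unfold gradient; rw [hdΘ0]; simp
      have hS0 : S z = 0 := by
        rw [hS]
        dsimp only
        rw [hg1, hg2, hΘ0', fderiv_sq_apply hΘ1, hΘ0', hdη]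
        simp
      rw [hS0, enorm_zero]
      exact zero_le
  -- ### Step 2: measurability and integrals of the majorant
  have hIcc_sub : ∀ t₂, t₂ ≤ t₀ → Icc a t₂ ×ˢ K ⊆
      Ioo (-R ^ 2) 0 ×ˢ ball (0 : EuclideanSpace ℝ (Fin 3)) (2 * R) := by
    intro t₂ ht₂
    refine prod_mono (fun s hs => ⟨ha.trans_le hs.1, hs.2.trans_lt (ht₂.trans_lt ht₀)⟩)
      (closedBall_subset_ball hρ₁R)
  have hUe : ∀ t₂, t₂ ≤ t₀ → AEMeasurable (fun z : ℝ × EuclideanSpace ℝ (Fin 3) => ‖U z.1 z.2‖ₑ)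
      (volume.restrict (Icc a t₂ ×ˢ K)) := by
    intro t₂ ht₂
    exact (hU.mono_measure (Measure.restrict_mono (hIcc_sub t₂ ht₂) le_rfl)).enorm
  have hρm : Measurable fun z : ℝ × EuclideanSpace ℝ (Fin 3) =>
      ENNReal.ofReal (cylRadius z.2)⁻¹ :=
    ENNReal.measurable_ofReal.comp ((continuous_cylRadius.measurable.comp measurable_snd).inv)
  have hGint : ∀ t₂, a ≤ t₂ → t₂ ≤ t₀ →
      ∫⁻ z in Icc a t₂ ×ˢ (univ : Set (EuclideanSpace ℝ (Fin 3))), G z ≤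
        ENNReal.ofReal c₁ * (ENNReal.ofReal (t₀ - a) * volume K) +
          ENNReal.ofReal c₂ * IU + ENNReal.ofReal c₃ * Iϱ := by
    intro t₂ hat₂ ht₂
    have hprodm : MeasurableSet ((univ : Set ℝ) ×ˢ K) := MeasurableSet.univ.prod hKm
    have h1 : ∫⁻ z in Icc a t₂ ×ˢ (univ : Set (EuclideanSpace ℝ (Fin 3))), G z =
        ∫⁻ z in Icc a t₂ ×ˢ K, F z := by
      rw [hG, lintegral_indicator hprodm, Measure.restrict_restrict hprodm, prod_inter_prod,
        univ_inter, inter_univ]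
    rw [h1]
    have hsplit : ∫⁻ z in Icc a t₂ ×ˢ K, F z =
        ENNReal.ofReal c₁ * volume (Icc a t₂ ×ˢ K) +
          ENNReal.ofReal c₂ * (∫⁻ z in Icc a t₂ ×ˢ K, ‖U z.1 z.2‖ₑ) +
          ENNReal.ofReal c₃ * (∫⁻ z in Icc a t₂ ×ˢ K, ENNReal.ofReal (cylRadius z.2)⁻¹) := by
      rw [hF]
      rw [lintegral_add_right _ (hρm.const_mul _), lintegral_add_left' aemeasurable_const,
        lintegral_const, Measure.restrict_apply_univ, lintegral_const_mul'' _ (hUe t₂ ht₂),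
        lintegral_const_mul _ hρm]
    rw [hsplit]
    have hvol : volume (Icc a t₂ ×ˢ K) ≤ ENNReal.ofReal (t₀ - a) * volume K := by
      calc volume (Icc a t₂ ×ˢ K) ≤ volume (Icc a t₀ ×ˢ K) :=
            measure_mono (prod_mono (Icc_subset_Icc le_rfl ht₂) le_rfl)
        _ = ENNReal.ofReal (t₀ - a) * volume K := by
            rw [Measure.volume_eq_prod, Measure.prod_prod, Real.volume_Icc]
    have hsubt : Icc a t₂ ×ˢ K ⊆ Icc a t₀ ×ˢ K := prod_mono (Icc_subset_Icc le_rfl ht₂) le_rfl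
    exact add_le_add (add_le_add (mul_le_mul' le_rfl hvol)
      (mul_le_mul' le_rfl ((lintegral_mono_set hsubt).trans hIU)))
      (mul_le_mul' le_rfl ((lintegral_mono_set hsubt).trans hIϱ))
  -- ### Step 3: the energy inequality between `a` and `t₀`
  have h' := hEC H hH2 hH' hH0 hH'' hHsq hHk Θ hΘ1 hΘc hΘsupp η hη1 hη0 a t₀ ha hat ht₀
  have h : ENNReal.ofReal (η t₀ * ∫ x, H (Φ t₀ x) * Θ x ^ 2) +
      ∫⁻ z in Icc a t₀ ×ˢ (univ : Set (EuclideanSpace ℝ (Fin 3))), ENNReal.ofReal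
        (1 / 2 * η z.1 * (deriv (deriv H) (Φ z.1 z.2) * ‖gradient (Φ z.1) z.2‖ ^ 2 *
          Θ z.2 ^ 2)) ≤
      ENNReal.ofReal (η a * (∫ x, H (Φ a x) * Θ x ^ 2) +
        ∫ z in Icc a t₀ ×ˢ (univ : Set (EuclideanSpace ℝ (Fin 3))), S z) := by
    simpa only [hS] using h'
  -- upper bound of the initial term by the sublevel measure at time `a`
  set L₀ : Set (EuclideanSpace ℝ (Fin 3)) :=
    ball (0 : EuclideanSpace ℝ (Fin 3)) ρ₁ ∩ {x | Φ a x < κ} with hL₀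
  have hL₀m : MeasurableSet L₀ :=
    measurableSet_ball.inter (measurableSet_lt (hΦm.comp (measurable_const.prodMk measurable_id))
      measurable_const)
  have hL₀fin : volume L₀ ≠ ∞ := (measure_mono inter_subset_left).trans_lt measure_ball_lt_top |>.ne
  have hMa : ∫ x, H (Φ a x) * Θ x ^ 2 ≤ κ ^ 3 * (volume L₀).toReal := by
    refine integral_le_of_le_indicator_const hL₀m hL₀fin (by positivity) (fun x _ => ?_)
      (fun x hx => ?_)
    · rw [abs_of_nonneg (mul_nonneg (hH0 _) (sq_nonneg _))]
      have hΘsq : Θ x ^ 2 ≤ 1 := by have := hΘ01 x; nlinarith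
      calc H (Φ a x) * Θ x ^ 2 ≤ 8 * l ^ 3 * 1 :=
          mul_le_mul (hH8 _ (hΦ0 _ _)) hΘsq (sq_nonneg _) (by positivity)
        _ = κ ^ 3 := by rw [← h2l]; ring
    · -- off `L₀`: either `‖x‖ ≥ ρ₁` (then `Θ x = 0`) or `Φ a x ≥ κ` (then `H = 0`)
      by_cases hxb : x ∈ ball (0 : EuclideanSpace ℝ (Fin 3)) ρ₁
      · have hΦx : κ ≤ Φ a x := by
          by_contra hlt
          exact hx ⟨hxb, not_le.1 hlt⟩
        have h0 : H (Φ a x) = 0 := hH2l _ (by rw [h2l]; exact hΦx)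
        rw [h0, zero_mul]
      · have : ρ₁ ≤ ‖x‖ := by rwa [mem_ball_zero_iff, not_lt] at hxb
        rw [show Θ x = 0 from radialCutoff_eq_zero hρ.le hρ₁ this]; simp
  -- lower bound of the final term by the sublevel measure at time `t₀`
  set L₁ : Set (EuclideanSpace ℝ (Fin 3)) :=
    ball (0 : EuclideanSpace ℝ (Fin 3)) ρ ∩ {x | Φ t₀ x < γ * κ} with hL₁
  have hL₁m : MeasurableSet L₁ :=
    measurableSet_ball.inter (measurableSet_lt (hΦm.comp (measurable_const.prodMk measurable_id))
      measurable_const)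
  have hL₁fin : volume L₁ ≠ ∞ := (measure_mono inter_subset_left).trans_lt measure_ball_lt_top |>.ne
  have hMt : ((1 - γ) * κ) ^ 3 * (volume L₁).toReal ≤ ∫ x, H (Φ t₀ x) * Θ x ^ 2 := by
    -- `f = H(Φ(t₀,·)) Θ²` is integrable (bounded, measurable, supported in `K`)
    have hfm : AEStronglyMeasurable (fun x => H (Φ t₀ x) * Θ x ^ 2) volume := by
      have h1 : Measurable fun x => Φ t₀ x := hΦm.comp (measurable_const.prodMk measurable_id)
      exact ((hH2.continuous.measurable.comp h1).mul
        ((hΘ1.continuous.pow 2).measurable)).aestronglyMeasurable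
    have hfi : Integrable (fun x => H (Φ t₀ x) * Θ x ^ 2) volume := by
      refine ⟨hfm, ?_⟩
      have hb : ∫⁻ x, ‖H (Φ t₀ x) * Θ x ^ 2‖ₑ ≤ ∫⁻ x, K.indicator (fun _ => ENNReal.ofReal (κ ^ 3)) x := by
        refine lintegral_mono fun x => ?_
        by_cases hx : x ∈ K
        · rw [indicator_of_mem hx, Real.enorm_eq_ofReal (mul_nonneg (hH0 _) (sq_nonneg _))]
          refine ENNReal.ofReal_le_ofReal ?_
          have hΘsq : Θ x ^ 2 ≤ 1 := by have := hΘ01 x; nlinarith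
          calc H (Φ t₀ x) * Θ x ^ 2 ≤ 8 * l ^ 3 * 1 :=
              mul_le_mul (hH8 _ (hΦ0 _ _)) hΘsq (sq_nonneg _) (by positivity)
            _ = κ ^ 3 := by rw [← h2l]; ring
        · rw [indicator_of_notMem hx, (hΘzero x hx).1]; simp
      rw [lintegral_indicator_const hKm] at hb
      exact lt_of_le_of_lt hb (ENNReal.mul_lt_top ENNReal.ofReal_lt_top hKfin)
    have hgi : Integrable (L₁.indicator fun _ => ((1 - γ) * κ) ^ 3) volume :=
      (integrable_indicator_iff hL₁m).2 (integrableOn_const hL₁fin)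
    have hle : ∀ x, L₁.indicator (fun _ => ((1 - γ) * κ) ^ 3) x ≤ H (Φ t₀ x) * Θ x ^ 2 := by
      intro x
      by_cases hx : x ∈ L₁
      · rw [indicator_of_mem hx, hΘone x hx.1, one_pow, mul_one]
        have h1 : (1 - γ) * κ ≤ max (2 * l - Φ t₀ x) 0 := by
          refine le_max_of_le_left ?_
          have := hx.2; rw [h2l]; simp only [mem_setOf_eq] at this; linarith
        have h0 : 0 ≤ (1 - γ) * κ := by nlinarith
        calc ((1 - γ) * κ) ^ 3 = ((1 - γ) * κ) ^ (3 : ℝ) := by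
              rw [show (3 : ℝ) = ((3 : ℕ) : ℝ) by norm_num, Real.rpow_natCast]
          _ ≤ max (2 * l - Φ t₀ x) 0 ^ (3 : ℝ) := Real.rpow_le_rpow h0 h1 (by norm_num)
      · rw [indicator_of_notMem hx]; exact mul_nonneg (hH0 _) (sq_nonneg _)
    have := integral_mono hgi hfi hle
    rwa [integral_indicator_const _ hL₁m, smul_eq_mul, mul_comm, Measure.real] at this
  -- the right-hand side integral
  have hS1 : (∫ z in Icc a t₀ ×ˢ (univ : Set (EuclideanSpace ℝ (Fin 3))), S z) ≤
      c₁ * ((t₀ - a) * VK) + c₂ * IU.toReal + c₃ * Iϱ.toReal := by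
    have hfinG : ENNReal.ofReal c₁ * (ENNReal.ofReal (t₀ - a) * volume K) +
        ENNReal.ofReal c₂ * IU + ENNReal.ofReal c₃ * Iϱ ≠ ∞ := by
      refine ENNReal.add_ne_top.2 ⟨ENNReal.add_ne_top.2 ⟨?_, ?_⟩, ?_⟩
      · exact ENNReal.mul_ne_top ENNReal.ofReal_ne_top
          (ENNReal.mul_ne_top ENNReal.ofReal_ne_top hKfin.ne)
      · exact ENNReal.mul_ne_top ENNReal.ofReal_ne_top hIUfin
      · exact ENNReal.mul_ne_top ENNReal.ofReal_ne_top hIϱfin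
    have h1 := norm_integral_le_lintegral_norm
      (μ := volume.restrict (Icc a t₀ ×ˢ (univ : Set (EuclideanSpace ℝ (Fin 3))))) S
    have h2 : ∫⁻ z in Icc a t₀ ×ˢ (univ : Set (EuclideanSpace ℝ (Fin 3))),
        ENNReal.ofReal ‖S z‖ ≤
        ENNReal.ofReal c₁ * (ENNReal.ofReal (t₀ - a) * volume K) +
          ENNReal.ofReal c₂ * IU + ENNReal.ofReal c₃ * Iϱ := by
      refine (lintegral_mono fun z => ?_).trans (hGint t₀ hat le_rfl)
      rw [ofReal_norm]; exact hSG z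
    calc (∫ z in Icc a t₀ ×ˢ (univ : Set (EuclideanSpace ℝ (Fin 3))), S z)
        ≤ ‖∫ z in Icc a t₀ ×ˢ (univ : Set (EuclideanSpace ℝ (Fin 3))), S z‖ := Real.le_norm_self _
      _ ≤ (ENNReal.ofReal c₁ * (ENNReal.ofReal (t₀ - a) * volume K) +
          ENNReal.ofReal c₂ * IU + ENNReal.ofReal c₃ * Iϱ).toReal :=
          h1.trans (ENNReal.toReal_mono hfinG h2)
      _ = c₁ * ((t₀ - a) * VK) + c₂ * IU.toReal + c₃ * Iϱ.toReal := by
          rw [ENNReal.toReal_add, ENNReal.toReal_add, ENNReal.toReal_mul, ENNReal.toReal_mul,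
            ENNReal.toReal_mul, ENNReal.toReal_mul, ENNReal.toReal_ofReal hc₁0,
            ENNReal.toReal_ofReal hc₂0, ENNReal.toReal_ofReal hc₃0,
            ENNReal.toReal_ofReal hta, hVK]
          · exact ENNReal.mul_ne_top ENNReal.ofReal_ne_top
              (ENNReal.mul_ne_top ENNReal.ofReal_ne_top hKfin.ne)
          · exact ENNReal.mul_ne_top ENNReal.ofReal_ne_top hIUfin
          · exact ENNReal.add_ne_top.2 ⟨ENNReal.mul_ne_top ENNReal.ofReal_ne_top
              (ENNReal.mul_ne_top ENNReal.ofReal_ne_top hKfin.ne),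
              ENNReal.mul_ne_top ENNReal.ofReal_ne_top hIUfin⟩
          · exact ENNReal.mul_ne_top ENNReal.ofReal_ne_top hIϱfin
  -- ### Step 4: combine
  have hMt' : ∫ x, H (Φ t₀ x) * Θ x ^ 2 ≤
      (∫ x, H (Φ a x) * Θ x ^ 2) + c₁ * ((t₀ - a) * VK) + c₂ * IU.toReal + c₃ * Iϱ.toReal := by
    have hle := le_trans le_self_add h
    simp only [hηz, one_mul] at hle
    have hMa0 : 0 ≤ ∫ x, H (Φ a x) * Θ x ^ 2 :=
      integral_nonneg fun x => mul_nonneg (hH0 _) (sq_nonneg _)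
    rcases (ENNReal.ofReal_le_ofReal_iff'.1 hle) with h1 | h1
    · linarith [hS1]
    · have hVK0 : 0 ≤ VK := ENNReal.toReal_nonneg
      have : 0 ≤ c₁ * ((t₀ - a) * VK) + c₂ * IU.toReal + c₃ * Iϱ.toReal :=
        add_nonneg (add_nonneg (mul_nonneg hc₁0 (mul_nonneg hta hVK0))
          (mul_nonneg hc₂0 ENNReal.toReal_nonneg)) (mul_nonneg hc₃0 ENNReal.toReal_nonneg)
      linarith
  have hc : c₁ * ((t₀ - a) * VK) + c₂ * IU.toReal + c₃ * Iϱ.toReal =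
      κ ^ 3 * (4 * A ^ 2 * ((t₀ - a) * VK) + 2 * A * IU.toReal + 4 * A * Iϱ.toReal) := by
    rw [hc₁, hc₂, hc₃, ← h2l]; ring
  linarith [hMt, hMt', hMa, hc]

end Summit.NavierStokesRegularity.NavierStokesRegularity.Theorems.AxisymmetricKatoGlobal.EulerScaling

end
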